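import Mathlib.Analysis.SpecialFunctions.Complex.Circle
import Mathlib.Analysis.LocallyConvex.WithSeminorms
import Mathlib.Topology.Algebra.Module.LocallyConvex
import Mathlib.Topology.Connected.LocallyPathConnected
import Mathlib.Topology.Homeomorph.Lemmas
import Literature.AlgebraicGeometry.Frobenioids.ArchimedeanCircleGeometry
import Literature.AlgebraicGeometry.Frobenioids.ArchimedeanTheoremsInstances
import HarnessLib

/-!
# Frobenioids II, Theorem 3.6 (vii), "`∂A_A` may be recovered functorially" — the hypotheses of
# Theorem A.2 (vi) PROVED for `C = C^ℤ` and `A`: `∂A_A` is sober and locally connected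

Mochizuki, *The geometry of Frobenioids II*, Kyushu J. Math. **62** (2008) 401–460, §3, Theorem 3.6
(vii), author's kurims text p. 38 [cite: MochizukiFrdII2008, Thm 3.6 (vii) p.38]: "In particular,
[cf. Theorem A.2, (vi)] the topological space `∂A_A` may be recovered functorially from the category
`F^imtr-pre_A`"; proof p. 39: "[since `S¹` is clearly sober and locally connected]".

DISCHARGE of the clause `ArchFrd.Thm36vii_recover` (the typed reading: `∂A_A` is sober and locally
connected, i.e. satisfies the hypotheses under which [FrdII] Thm. A.2 (vi) recovers a space from
`Open⁰(−)`) at the archimedean Frobenioid `C π` of Example 3.3 (instance of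
`ArchimedeanTheoremsInstances.lean`: ambient space `ℂ^×`, `∂A_A = {u ∈ A_A : |u| = tip(A)}`) and at the
angular Frobenioid `A ⊆ C`, over ANY base `π : D → D₀`:

* soberness: `∂A_A ⊆ ℂ^×` is Hausdorff, hence sober (`T2 ⇒` quasi-sober and `T₀`);
* local connectedness: `z ↦ z · tip(A)` is a homeomorphism of the angular part `B ⊆ O_ℂ^× = S¹` (an OPEN
  subset, Def. 3.1 (iii)) onto `∂A_A` ("`∂A` maps bijectively via the projection `K^× → O_K^×` to `B`",
  Def. 3.1 (iii)), and `S¹ ≅ ℝ/2πℤ` is locally (path) connected as a quotient of `ℝ`.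

The hypothesis "`A` complex" of (vii) is not needed for this clause. No statement of the paper is
strengthened; nothing here bears on [IUTchIII].
-/

namespace Literature.AlgebraicGeometry.Frobenioids

open CategoryTheory Topology

universe v u

namespace ArchFrd

/-! ### `S¹` and its open subsets are locally connected -/

/-- Mathlib's `Circle` (`S¹`) is locally connected: it is homeomorphic to `ℝ/2πℤ`, a quotient of the
locally path connected space `ℝ` ("`S¹` is clearly … locally connected", proof of Thm. 3.6 (vii), p. 39).
[cite: MochizukiFrdII2008, Thm 3.6 (vii) p.39] -/
theorem locallyConnectedSpace_circle : LocallyConnectedSpace Circle := by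
  haveI : LocallyPathConnectedSpace (AddCircle (2 * Real.pi)) :=
    (QuotientAddGroup.isQuotientMap_mk _).locallyPathConnectedSpace
  exact AddCircle.homeomorphCircle'.symm.locallyConnectedSpace

/-- `O_ℂ^× ⊆ ℂ^×` (`normOneSubgroup ℂ`, homeomorphic to `Circle` by `ArchimedeanCircleGeometry`) is
locally connected. [cite: MochizukiFrdII2008, Thm 3.6 (vii) p.39] -/
theorem locallyConnectedSpace_normOne : LocallyConnectedSpace ↥(normOneSubgroup ℂ) := by
  obtain ⟨_, h, -, -⟩ := exists_unitCircleEquiv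
  haveI := locallyConnectedSpace_circle
  exact h.symm.locallyConnectedSpace

/-- The angular part `B ⊆ O_ℂ^×` of an angular region, an open subset (Def. 3.1 (iii)), is locally
connected. [cite: MochizukiFrdII2008, Def 3.1 (iii) p.24] -/
theorem AngularRegion.locallyConnectedSpace_dir (A : AngularRegion ℂ) : LocallyConnectedSpace ↥A.dir := by
  haveI := locallyConnectedSpace_normOne
  exact A.isOpen_dir.locallyConnectedSpace

/-! ### `∂A ≅ B`: the boundary is homeomorphic to the angular part -/

/-- The map `B → ℂ^×`, `z ↦ z · λ` (`λ = tip(A)`), whose image is `∂A` (Def. 3.1 (iii): "`∂A` maps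
bijectively via the projection `K^× → O_K^×` to `B`"). [cite: MochizukiFrdII2008, Def 3.1 (iii) p.24] -/
noncomputable def AngularRegion.dirToUnits (A : AngularRegion ℂ) (z : ↥A.dir) : ℂˣ :=
  ((z : ↥(normOneSubgroup ℂ)) : ℂˣ) * ofPosReal ℂ A.tip

/-- `z ↦ z · λ` is a topological embedding `B ↪ ℂ^×` (a translate of the inclusions `B ⊆ O_ℂ^× ⊆ ℂ^×`).
[cite: MochizukiFrdII2008, Def 3.1 (iii) p.24] -/
theorem AngularRegion.isEmbedding_dirToUnits (A : AngularRegion ℂ) : IsEmbedding A.dirToUnits :=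
  ((Homeomorph.mulRight (ofPosReal ℂ A.tip)).isEmbedding.comp IsEmbedding.subtypeVal).comp
    IsEmbedding.subtypeVal

/-- The image of `z ↦ z · λ` is exactly the boundary `∂A` (Def. 3.1 (iii), via the canonical
decomposition `O_K^× × ord(K^×) ≅ K^×` of Def. 3.1 (ii)). [cite: MochizukiFrdII2008, Def 3.1 (iii) p.24] -/
theorem AngularRegion.range_dirToUnits (A : AngularRegion ℂ) : Set.range A.dirToUnits = A.boundary := by
  ext u
  constructor
  · rintro ⟨z, rfl⟩
    have e := Prod.ext_iff.mp ((unitDecomposition ℂ).symm_apply_apply ((z : ↥(normOneSubgroup ℂ)), A.tip))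
    have h1 : unitPart ℂ (A.dirToUnits z) = (z : ↥(normOneSubgroup ℂ)) := e.1
    have h2 : absHom ℂ (A.dirToUnits z) = A.tip := e.2
    exact ⟨⟨by rw [h1]; exact z.2, by rw [h2]⟩, h2⟩
  · intro hu
    refine ⟨⟨unitPart ℂ u, hu.1.1⟩, ?_⟩
    have h : ((unitPart ℂ u : ↥(normOneSubgroup ℂ)) : ℂˣ) * ofPosReal ℂ (absHom ℂ u) = u :=
      (unitDecomposition ℂ).apply_symm_apply u
    rw [hu.2] at h
    exact h

/-- `B ≅ ∂A` as topological spaces. [cite: MochizukiFrdII2008, Def 3.1 (iii) p.24] -/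
noncomputable def AngularRegion.dirHomeoBoundary (A : AngularRegion ℂ) : ↥A.dir ≃ₜ ↥A.boundary :=
  A.isEmbedding_dirToUnits.toHomeomorph.trans (Homeomorph.setCongr A.range_dirToUnits)

/-- The boundary `∂A ⊆ ℂ^×` of an angular region is locally connected.
[cite: MochizukiFrdII2008, Thm 3.6 (vii) p.38] -/
theorem AngularRegion.locallyConnectedSpace_boundary (A : AngularRegion ℂ) :
    LocallyConnectedSpace ↥A.boundary := by
  haveI := A.locallyConnectedSpace_dir
  exact A.dirHomeoBoundary.symm.locallyConnectedSpace

/-- The boundary `∂A ⊆ ℂ^×` of an angular region is sober (it is Hausdorff).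
[cite: MochizukiFrdII2008, Thm 3.6 (vii) p.38] -/
theorem AngularRegion.isSober_boundary (A : AngularRegion ℂ) : TopRep.IsSober ↥A.boundary := by
  rw [TopRep.isSober_iff_quasiSober]
  exact ⟨inferInstance, inferInstance⟩

/-! ### Theorem 3.6 (vii), recovery clause, for `C` and `A` -/

variable {D : Type u} [Category.{v} D] (π : D ⥤ D0)

/-- **Theorem 3.6 (vii), "`∂A_A` may be recovered functorially from `F^imtr-pre_A` [cf. Theorem A.2,
(vi)]", for `C = C^ℤ`** (PROVED, typed reading): for every (complex) `A ∈ Ob(C)`, `∂A_A` is sober and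
locally connected. [cite: MochizukiFrdII2008, Thm 3.6 (vii) p.38] -/
theorem thm36vii_recover_C :
    Thm36vii_recover (baseRC π) (C.toElem π) MonoidType.Z (ambient π) (bd π) := by
  intro _ A _
  exact ⟨A.fst.region.isSober_boundary, A.fst.region.locallyConnectedSpace_boundary⟩

/-- **Theorem 3.6 (vii), recovery clause, for the angular Frobenioid `A`** (PROVED, typed reading).
[cite: MochizukiFrdII2008, Thm 3.6 (vii) p.38] -/
theorem thm36vii_recover_A :
    Thm36vii_recover (baseRC π) (A.toElem π) MonoidType.Z (fun X => ambient π X.obj) (bdA π) := by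
  intro _ X _
  exact ⟨X.obj.fst.region.isSober_boundary, X.obj.fst.region.locallyConnectedSpace_boundary⟩

end ArchFrd

end Literature.AlgebraicGeometry.Frobenioids
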